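import Summits.CriticalPhenomena.PercolationContinuityZ3.Theorems.PercNearOneGluingNoHeavyLowerTailOwnDisconnection
import Literature.Probability.Percolation.FoldingFibresHarris
import HarnessLib

/-!
# `NoHeavyLowerTail` (stmt-CriticalPhenomena-4575) — "OWN CONNECTION HELPS MOST": a four-point covariance
# comparison, the first rung of the covariance-gluing chain (U)

Support file (prover prim-gen-kcluster gen 4; `--supports stmt-CriticalPhenomena-4575`).  No definitions, no sorries.

For bond percolation with arbitrary edge probabilities on a finite vertex type, vertices `o, x, y, b`:

* `ownConnection_cov_le` (PROVED, new):  if `μ(y ↮ b) ≤ μ(x ↮ b)` (`x` is the worse relay) then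

      `Cov(1{o ↔ x}, 1{y ↔ b}) ≤ Cov(1{o ↔ x}, 1{x ↔ b})`,   i.e.
      `μ({o↔x}∩{y↔b}) − μ(o↔x)·μ(y↔b) ≤ μ({o↔x}∩{x↔b}) − μ(o↔x)·μ(x↔b)`:

  the connection event `{o ↔ x}` is more correlated with its own endpoint's connection to the sink than with the
  connection of any better-connected vertex `y`.  This is the `|S| = 1` case (V₁) of the telescoped form of
  COVARIANCE GLUING (U) (`Theorems.CovarianceGluing.eventGluing_of_covGluing`):
  `(U) = Σ_{j<k} [Cov(o↔A_{≤j}, a_j↔b) − Cov(o↔A_{≤j}, a_{j+1}↔b)] + Cov(o↔A, a_k↔b)`, whose `j = 1` bracket is exactly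
  this theorem (the brackets `j ≥ 2` are false termwise; the sum is the conjecture).  It is NOT implied by and does not
  imply the landed ratio statement `ownDisconnection_le` (`μ(o↔x | x↮b) ≤ μ(o↔x | y↮b)`).
  Proof (trace decomposition on `{x↔b, y↔b}`): with `G = {x↔b, y↮b}`, `F = {y↔b, x↮b}`, `Q = {o↔x}` the claim is
  `μ(QG) − μ(QF) + μ(Q)(μ(F) − μ(G)) ≥ 0`; the ingredients are the `diamond` `μ(QF)μ(G) ≤ μ(QG)μ(F)`, the bound
  `μ(QF) ≤ μ(Q)μ(F)` (BHK 2006 Thm 1.4 negative correlation of `{o↔x}`, `{y↔b}` given `{x↮b}`, then Harris), and `μ(G) ≤ μ(F)`.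
Census (exact partition DP, seat folder num/t_U.py, t_Z.py): 0 violations in > 3 000 instances (also as `K₁₁ ≥ K₁ᵢ` for every
better relay `a_i`), while the analogous comparison for the later worst-first events `{o↔a_j, o↮A_{<j}}` (j ≥ 2) fails.
-/

noncomputable section

namespace Summit.CriticalPhenomena.PercolationContinuityZ3.Theorems

open MeasureTheory Set Literature.Probability.LatticeModels Literature.Probability.Percolation
open scoped Classical

namespace OwnConnection

open OwnDisconnection

variable {V : Type*}

/-- BHK negative correlation plus Harris: `μ({o↔x}∩{y↔b}∩{x↮b}) ≤ μ(o↔x) · μ({y↔b}∩{x↮b})`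
(given `x ↮ b`, joining `y` to `b` lowers `o ↔ x`, and `x ↮ b` itself lowers `o ↔ x`). [folklore] -/
theorem attach_other_le [Fintype V] (w : Sym2 V → unitInterval) (o x y b : V) :
    (prodBernoulli w).real (openConn o x ∩ openConn y b ∩ (openConn x b)ᶜ) ≤
      (prodBernoulli w).real (openConn o x : Set (BondConfig V)) *
        (prodBernoulli w).real (openConn y b ∩ (openConn x b)ᶜ) := by
  set μ := prodBernoulli w with hμ
  set D := μ.real (openConn x b : Set (BondConfig V))ᶜ with hD
  set F := μ.real (openConn y b ∩ (openConn x b)ᶜ) with hF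
  set QF := μ.real (openConn o x ∩ openConn y b ∩ (openConn x b)ᶜ) with hQF
  set QD := μ.real (openConn o x ∩ (openConn x b)ᶜ) with hQD
  set Q := μ.real (openConn o x : Set (BondConfig V)) with hQ
  have hF0 : 0 ≤ F := measureReal_nonneg
  have hQ0 : 0 ≤ Q := measureReal_nonneg
  -- Harris (increasing × decreasing): QD ≤ Q · D
  have hH : QD ≤ Q * D := by
    have := prodBernoulli_harris_upper_lower_via_fibres w (isUpperSet_openConn o x)
      (isUpperSet_openConn x b).compl
    simpa [hQD, hQ, hD] using this
  by_cases hbx : b = x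
  · -- then `{x ↮ b} = ∅`
    have hQF0 : QF = 0 := by
      have hsub : (openConn o x ∩ openConn y b ∩ (openConn x b)ᶜ : Set (BondConfig V)) ⊆ ∅ := by
        rintro ω ⟨_, h⟩
        simp only [mem_compl_iff, openConn, mem_setOf_eq, hbx] at h
        exact h (SimpleGraph.Reachable.refl x)
      exact le_antisymm (le_trans (measureReal_mono hsub) (le_of_eq measureReal_empty)) measureReal_nonneg
    rw [hQF0]; exact mul_nonneg hQ0 hF0
  -- BHK 2006 Thm 1.4 (clusters of `b` and `x` on `{b ↮ x}`):  D · QF ≤ F · QD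
  have hN : D * QF ≤ F * QD := by
    have key := BHK2006_twoClusterConditionalAssociation_holds.openConn_negCorrelation V w b x y o hbx
    have s1 : (openConn b x : Set (BondConfig V)) = openConn x b := KNPreFKG.openConn_symm b x
    have s2 : (openConn b y : Set (BondConfig V)) = openConn y b := KNPreFKG.openConn_symm b y
    have s3 : (openConn x o : Set (BondConfig V)) = openConn o x := KNPreFKG.openConn_symm x o
    rw [s1, s2, s3] at key
    have e1 : ((openConn x b : Set (BondConfig V))ᶜ ∩ (openConn y b ∩ openConn o x)) =
        openConn o x ∩ openConn y b ∩ (openConn x b)ᶜ := by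
      ext ω; simp only [mem_inter_iff, mem_compl_iff]; tauto
    have e2 : ((openConn x b : Set (BondConfig V))ᶜ ∩ openConn y b) = openConn y b ∩ (openConn x b)ᶜ :=
      Set.inter_comm _ _
    have e3 : ((openConn x b : Set (BondConfig V))ᶜ ∩ openConn o x) = openConn o x ∩ (openConn x b)ᶜ :=
      Set.inter_comm _ _
    rw [e1, e2, e3] at key
    exact key
  rcases eq_or_lt_of_le (measureReal_nonneg : 0 ≤ D) with hD0 | hDpos
  · -- D = 0 forces QF = 0
    have hQF0 : QF = 0 := by
      have h1 : QF ≤ D := measureReal_mono (fun ω hω => hω.2)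
      have hD0' : D = 0 := by rw [hD]; exact hD0.symm
      exact le_antisymm (by linarith) measureReal_nonneg
    rw [hQF0]; exact mul_nonneg hQ0 hF0
  · -- D · QF ≤ F · QD ≤ F · Q · D
    have h2 : D * QF ≤ D * (Q * F) := by nlinarith [hN, hH, hF0]
    exact le_of_mul_le_mul_left h2 hDpos

/-- **Own connection helps most (PROVED).**  If `μ(y ↮ b) ≤ μ(x ↮ b)` then
`Cov(1{o↔x}, 1{y↔b}) ≤ Cov(1{o↔x}, 1{x↔b})`, i.e.
`μ({o↔x}∩{y↔b}) − μ(o↔x)·μ(y↔b) ≤ μ({o↔x}∩{x↔b}) − μ(o↔x)·μ(x↔b)`. [this file] -/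
theorem ownConnection_cov_le [Fintype V] (w : Sym2 V → unitInterval) (o x y b : V)
    (hd : (prodBernoulli w).real (openConn y b : Set (BondConfig V))ᶜ ≤
      (prodBernoulli w).real (openConn x b : Set (BondConfig V))ᶜ) :
    (prodBernoulli w).real (openConn o x ∩ openConn y b) -
        (prodBernoulli w).real (openConn o x : Set (BondConfig V)) *
          (prodBernoulli w).real (openConn y b : Set (BondConfig V)) ≤
      (prodBernoulli w).real (openConn o x ∩ openConn x b) -
        (prodBernoulli w).real (openConn o x : Set (BondConfig V)) *
          (prodBernoulli w).real (openConn x b : Set (BondConfig V)) := by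
  set μ := prodBernoulli w with hμ
  have hdia := diamond w o x y b
  have hatt := attach_other_le w o x y b
  -- numbers
  set D := μ.real (openConn x b : Set (BondConfig V))ᶜ with hD
  set Yc := μ.real (openConn y b : Set (BondConfig V))ᶜ with hYc
  set F := μ.real (openConn y b ∩ (openConn x b)ᶜ) with hF
  set G := μ.real (openConn x b ∩ (openConn y b)ᶜ) with hG
  set QF := μ.real (openConn o x ∩ openConn y b ∩ (openConn x b)ᶜ) with hQF
  set QG := μ.real (openConn o x ∩ openConn x b ∩ (openConn y b)ᶜ) with hQG
  set Q := μ.real (openConn o x : Set (BondConfig V)) with hQ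
  set Z := μ.real ((openConn x b : Set (BondConfig V))ᶜ ∩ (openConn y b)ᶜ) with hZ
  set B2 := μ.real (openConn x b ∩ openConn y b : Set (BondConfig V)) with hB2
  set QB2 := μ.real (openConn o x ∩ openConn x b ∩ openConn y b : Set (BondConfig V)) with hQB2
  -- bookkeeping identities
  have iD : D = Z + F := by
    have := split w ((openConn x b : Set (BondConfig V))ᶜ) ((openConn y b)ᶜ)
    rw [compl_compl] at this
    have e : ((openConn x b : Set (BondConfig V))ᶜ ∩ openConn y b) = openConn y b ∩ (openConn x b)ᶜ :=
      Set.inter_comm _ _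
    rw [e] at this; linarith
  have iY : Yc = Z + G := by
    have := split w ((openConn y b : Set (BondConfig V))ᶜ) ((openConn x b)ᶜ)
    rw [compl_compl] at this
    have e1 : ((openConn y b : Set (BondConfig V))ᶜ ∩ (openConn x b)ᶜ) = (openConn x b)ᶜ ∩ (openConn y b)ᶜ :=
      Set.inter_comm _ _
    have e2 : ((openConn y b : Set (BondConfig V))ᶜ ∩ openConn x b) = openConn x b ∩ (openConn y b)ᶜ :=
      Set.inter_comm _ _
    rw [e1, e2] at this; linarith
  have iCx : μ.real (openConn x b : Set (BondConfig V)) = B2 + G := by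
    have := split w (openConn x b : Set (BondConfig V)) (openConn y b)
    linarith
  have iCy : μ.real (openConn y b : Set (BondConfig V)) = B2 + F := by
    have := split w (openConn y b : Set (BondConfig V)) (openConn x b)
    have e1 : (openConn y b ∩ openConn x b : Set (BondConfig V)) = openConn x b ∩ openConn y b := Set.inter_comm _ _
    rw [e1] at this; linarith
  have iQCx : μ.real (openConn o x ∩ openConn x b : Set (BondConfig V)) = QB2 + QG := by
    have := split w (openConn o x ∩ openConn x b : Set (BondConfig V)) (openConn y b)
    linarith
  have iQCy : μ.real (openConn o x ∩ openConn y b : Set (BondConfig V)) = QB2 + QF := by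
    have := split w (openConn o x ∩ openConn y b : Set (BondConfig V)) (openConn x b)
    have e1 : (openConn o x ∩ openConn y b ∩ openConn x b : Set (BondConfig V)) =
        openConn o x ∩ openConn x b ∩ openConn y b := by
      ext ω; simp only [mem_inter_iff]; tauto
    rw [e1] at this; linarith
  have hGF : G ≤ F := by linarith
  have hG0 : 0 ≤ G := measureReal_nonneg
  have hF0 : 0 ≤ F := measureReal_nonneg
  have hQ0 : 0 ≤ Q := measureReal_nonneg
  have hQF0 : 0 ≤ QF := measureReal_nonneg
  have hQG0 : 0 ≤ QG := measureReal_nonneg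
  have hQGle : QG ≤ G := measureReal_mono (fun ω hω => ⟨hω.1.2, hω.2⟩)
  -- goal: QG − QF + Q (F − G) ≥ 0
  rw [iQCx, iQCy, iCx, iCy]
  rcases eq_or_lt_of_le hG0 with hG00 | hGpos
  · -- G = 0 ⇒ QG = 0; then Q·F − QF ≥ 0
    have hQG00 : QG = 0 := le_antisymm (by rw [hG00]; exact hQGle) hQG0
    rw [← hG00, hQG00]
    nlinarith [hatt]
  · by_cases hcase : Q * G ≤ QG
    · nlinarith [hatt, hcase]
    · push Not at hcase
      -- G·(QG − QF + Q(F−G)) ≥ G QG − G QF + QG (F − G) = QG F − G QF ≥ 0 (diamond)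
      have step : G * (QG - QF + Q * (F - G)) ≥ 0 := by
        nlinarith [hdia, hcase, hGF, sub_nonneg.2 hGF]
      nlinarith [step, hGpos]

end OwnConnection

end Summit.CriticalPhenomena.PercolationContinuityZ3.Theorems

end
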